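import Literature.Analysis.FluidPDE.ShearStageTransport
import Literature.Analysis.FluidPDE.PassiveScalarClassicalEnergy
import HarnessLib

/-!
# K1loc, line `Spectral` / SeqCone — helper: THE LAGRANGIAN PULL-BACK OF A CLASSICAL SCALAR ALONG A SHEAR SLOT

Helper file of the prover lane on the crux `K1LocalisedCascade` (stmt-AnomalousDissipation-19491), route
`SawtoothPulseCascade`, for the OPEN piece S3b of the architecture note attached to the item (evidence
`K1loc-architecture-findings-k1locp1.md`, F-b: "viscous bookkeeping is κ-uniform without restart blocks — fibrewise
shear gauge").  On an H (resp. V) half-slot the cascade field is a single shear `u(t,x) = ρ(t) φ(x_j) eᵢ`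
(`SawtoothCascade.CascadeParams.field_eq_of_mem_H/V`; in the tree's vocabulary `ShearStage.drift i j φ (ρ t)`), so the
slot has an explicit Lagrangian flow `Φ_t : x ↦ x + Γ(t) φ(x_j) eᵢ`, `Γ(t) = ∫_{t₀}^t ρ`
(`= Torus.shearMap i j (ShearStage.amp φ (−Γ t))`).  The "gauge" of the note is the pull-back
`G(t) = θ(t) ∘ Φ_t = ShearStage.moved θ i j φ (−Γ) t`.  This file proves, for `𝕋^d` / `𝕋²`:

* `partialDeriv_comp_shearMap` — the CHAIN RULE `∂_l(f ∘ Φ) = (∂_l f) ∘ Φ − [l = j] φ'(x_j) (∂ᵢ f) ∘ Φ` for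
  `Φ = shearMap i j φ`, with the slope written in tree vocabulary as `∂ⱼ (x ↦ φ(x_j))`
  (`partialDeriv_onCircle_comp`);
* `isSmoothSpaceTimeOn_moved_of_contDiffOn`, `hasDerivWithinAt_moved`, `timeDerivWithin_moved` — joint smoothness
  of the pull-back on a time set `S` when `Γ` is smooth on `S`, and its one-sided time derivative
  `∂ₜG(t,x) = ∂ₜθ(t, Φ_t x) + ρ(t) φ(x_j) (∂ᵢθ)(t, Φ_t x)` (`Γ' = ρ` within `S`);
* `timeDerivWithin_moved_eq_laplacian` — **the pull-back solves the pulled-back heat equation**: for a classical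
  solution of `∂ₜθ + u·∇θ = κΔθ` (`Torus.IsClassicalScalarTransportOn`) with `u(t) = ShearStage.drift i j φ (ρ t)`,
  `∂ₜG(t, x) = κ (Δθ(t))(Φ_t x)` — the transport term is absorbed by the gauge;
* `integral_mul_laplacian_comp_shear` — **the pulled-back Green identity** on `𝕋²`:
  `∫ a(x) (Δθ)(Φ x) dx = −∫ (∂ᵢa ∂ᵢG + D̄a D̄G)` with `G = θ ∘ Φ` and the transversal slot derivative
  `D̄ = ∂ⱼ − c φ'(x_j) ∂ᵢ` (change of variables `Torus.integral_comp_shearMap`, Green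
  `Torus.integral_mul_laplacian_eq_neg_sum`, and the chain rule twice).

These are the kinematic inputs of the slot lemma (companion files).  WHAT THIS IS NOT: no statement about the
cascade or the stub itself; no new definitions (the tree's `ShearStage.amp/drift/moved`, `Torus.shearMap` are reused).
[cite: BardosTitiWiedemann2012, Lemma 4 (transport by a shear flow is composition with the shear map)]
[cite: BedrossianCotiZelati2017, §2 (shear coordinates `(x − t v(y), y)` for advection–diffusion by a shear)] [problem: turb]
-/

-- `Summit.<Summit>.<Problem>`: single-conjunct summit, the duplicate namespace segment is deliberate.
set_option linter.dupNamespace false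

noncomputable section

namespace Summit.AnomalousDissipation.AnomalousDissipation.Theorems.SawtoothPulseCascade.K1Slot

open MeasureTheory Set Filter Topology UnitAddTorus Function
open scoped ContDiff InnerProductSpace
open Literature.Analysis Literature.Analysis.FunctionSpaces Literature.Analysis.FunctionSpaces.Torus
open Literature.Analysis.FluidPDE.ShearStage

variable {d : Type*} [Fintype d] [DecidableEq d]

/-! ## Smooth profiles: the planar derivative and the slope function `x ↦ φ'(x_j)` -/

omit [Fintype d] [DecidableEq d] in
/-- A shear profile is differentiable with derivative `deriv φ`. [folklore] -/
theorem hasDerivAt_profile (P : ShearProfile) (t : ℝ) : HasDerivAt P (deriv P t) t :=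
  (P.contDiff.differentiable (by simp)).differentiableAt.hasDerivAt

omit [DecidableEq d] in
/-- `x ↦ φ(x_j)` is smooth on `T^d` (general `d`; the tree's `ShearStage.isSmooth_onCircle_comp` is `d = Fin 2`).
[folklore] -/
theorem isSmooth_onCircle_comp' (P : ShearProfile) (j : d) :
    IsSmooth (fun x : UnitAddTorus d => P.onCircle (x j)) := by
  have h : lift (fun x : UnitAddTorus d => P.onCircle (x j)) = fun y => P (y j) := by
    funext y; simp [lift_apply, proj_apply]
  change ContDiff ℝ ∞ (lift fun x : UnitAddTorus d => P.onCircle (x j))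
  rw [h]
  exact P.contDiff.comp (EuclideanSpace.proj j : EuclideanSpace ℝ d →L[ℝ] ℝ).contDiff

/-- **The slope function.** `∂_l (x ↦ φ(x_j)) (proj y) = [l = j] φ'(y_j)`: the torus partial derivative of the
profile read off the `j`-th coordinate is the planar derivative of the profile. [folklore] -/
theorem partialDeriv_onCircle_comp (P : ShearProfile) (j l : d) (y : EuclideanSpace ℝ d) :
    partialDeriv l (fun x : UnitAddTorus d => P.onCircle (x j)) (proj y) =
      if l = j then deriv P (y j) else 0 := by
  have h1 : IsContDiff 1 (fun x : UnitAddTorus d => P.onCircle (x j)) :=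
    (isSmooth_onCircle_comp' P j).isContDiff (by simp)
  rw [partialDeriv_eq_fderiv_apply h1, ← fderiv_lift]
  have h : lift (fun x : UnitAddTorus d => P.onCircle (x j)) = fun y => P (y j) := by
    funext y; simp [lift_apply, proj_apply]
  rw [h]
  have hP : HasFDerivAt (fun y : EuclideanSpace ℝ d => P (y j))
      (deriv P (y j) • (EuclideanSpace.proj j : EuclideanSpace ℝ d →L[ℝ] ℝ)) y :=
    (hasDerivAt_profile P (y j)).comp_hasFDerivAt y
      (EuclideanSpace.proj j : EuclideanSpace ℝ d →L[ℝ] ℝ).hasFDerivAt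
  rw [hP.fderiv]
  by_cases hl : l = j
  · subst hl; simp
  · simp [hl]

/-- The slope function does not depend on the coordinates `l ≠ j`: `∂_l (x ↦ φ(x_j)) = 0`. [folklore] -/
theorem partialDeriv_onCircle_comp_of_ne (P : ShearProfile) {j l : d} (hl : l ≠ j) (x : UnitAddTorus d) :
    partialDeriv l (fun x : UnitAddTorus d => P.onCircle (x j)) x = 0 := by
  obtain ⟨y, rfl⟩ := proj_surjective x
  rw [partialDeriv_onCircle_comp, if_neg hl]

/-- The slope function of the scaled profile `c•φ` is `c` times that of `φ`. [folklore] -/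
theorem partialDeriv_onCircle_comp_amp (P : ShearProfile) (c : ℝ) (j : d) (x : UnitAddTorus d) :
    partialDeriv j (fun x : UnitAddTorus d => (amp P c).onCircle (x j)) x =
      c * partialDeriv j (fun x : UnitAddTorus d => P.onCircle (x j)) x := by
  obtain ⟨y, rfl⟩ := proj_surjective x
  rw [partialDeriv_onCircle_comp, partialDeriv_onCircle_comp, if_pos rfl, if_pos rfl]
  change deriv (fun s => c * P s) (y j) = c * deriv P (y j)
  exact ((hasDerivAt_profile P (y j)).const_mul c).deriv

/-! ## The planar lift of the shear map and the chain rule -/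

/-- The planar lift `y ↦ y − φ(y_j) eᵢ` of the shear map has derivative `v ↦ v − φ'(y_j) v_j eᵢ`. [folklore] -/
theorem hasFDerivAt_shearMapLift (i j : d) (P : ShearProfile) (y : EuclideanSpace ℝ d) :
    HasFDerivAt (shearMapLift i j P)
      ((ContinuousLinearMap.id ℝ (EuclideanSpace ℝ d)) -
        (deriv P (y j) • (EuclideanSpace.proj j : EuclideanSpace ℝ d →L[ℝ] ℝ)).smulRight
          (EuclideanSpace.single i (1 : ℝ))) y := by
  unfold shearMapLift
  have hP : HasFDerivAt (fun y : EuclideanSpace ℝ d => P (y j))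
      (deriv P (y j) • (EuclideanSpace.proj j : EuclideanSpace ℝ d →L[ℝ] ℝ)) y :=
    (hasDerivAt_profile P (y j)).comp_hasFDerivAt y
      (EuclideanSpace.proj j : EuclideanSpace ℝ d →L[ℝ] ℝ).hasFDerivAt
  exact (hasFDerivAt_id y).sub (hP.smul_const _)

/-- The derivative of the planar lift of the shear map, applied to a vector. [folklore] -/
theorem fderiv_shearMapLift_apply (i j : d) (P : ShearProfile) (y v : EuclideanSpace ℝ d) :
    fderiv ℝ (shearMapLift i j P) y v = v - (deriv P (y j) * v j) • EuclideanSpace.single i (1 : ℝ) := by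
  rw [(hasFDerivAt_shearMapLift i j P y).fderiv]
  simp

/-- **Chain rule for a transversal shear.** For smooth `f` on `T^d` and `Φ = shearMap i j φ`
(`x ↦ x − φ(x_j)eᵢ`): `∂_l (f ∘ Φ)(x) = (∂_l f)(Φ x) − [l = j] φ'(x_j) (∂ᵢ f)(Φ x)`, the slope written as
`∂ⱼ (x ↦ φ(x_j))`. [cite: BardosTitiWiedemann2012, Lemma 4] -/
theorem partialDeriv_comp_shearMap {F : Type*} [NormedAddCommGroup F] [NormedSpace ℝ F]
    {f : UnitAddTorus d → F} (hf : IsSmooth f) (i j : d) (P : ShearProfile) (l : d)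
    (x : UnitAddTorus d) :
    partialDeriv l (f ∘ shearMap i j P) x =
      partialDeriv l f (shearMap i j P x) -
        (if l = j then partialDeriv j (fun x : UnitAddTorus d => P.onCircle (x j)) x •
          partialDeriv i f (shearMap i j P x) else 0) := by
  obtain ⟨y, rfl⟩ := proj_surjective x
  have hg : IsSmooth (f ∘ shearMap i j P) := hf.comp_shearMap i j P
  have h1 : IsContDiff 1 f := hf.isContDiff (by simp)
  have hg1 : IsContDiff 1 (f ∘ shearMap i j P) := hg.isContDiff (by simp)
  rw [partialDeriv_eq_fderiv_apply hg1, ← fderiv_lift, lift_comp_shearMap]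
  have hdf : DifferentiableAt ℝ (lift f) (shearMapLift i j P y) :=
    (hf.differentiable (by simp)).differentiableAt
  have hdS : DifferentiableAt ℝ (shearMapLift i j P) y :=
    (hasFDerivAt_shearMapLift i j P y).differentiableAt
  rw [fderiv_comp y hdf hdS, ContinuousLinearMap.comp_apply, fderiv_shearMapLift_apply,
    map_sub, map_smul, fderiv_lift, ← shearMap_proj, ← partialDeriv_eq_fderiv_apply h1,
    ← partialDeriv_eq_fderiv_apply h1, partialDeriv_onCircle_comp]
  congr 1
  by_cases hl : l = j
  · subst hl; simp
  · simp [hl]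

omit [Fintype d] in
/-- `shearMap (c•φ)` undoes `shearMap ((-c)•φ)` (`i ≠ j`). [folklore] -/
theorem shearMap_amp_neg_apply {i j : d} (hij : i ≠ j) (c : ℝ) (P : ShearProfile) (x : UnitAddTorus d) :
    shearMap i j (amp P c) (shearMap i j (amp P (-c)) x) = x := by
  have h : amp P c = (amp P (-c)).neg := by
    simp only [amp, ShearProfile.neg]
    congr 1; funext t; ring
  rw [h]
  exact shearMap_neg_shearMap hij _ x

omit [Fintype d] in
/-- The planar formula for a scaled shear: `shearMap i j ((-c)•φ) (proj y) = proj (y + c φ(y_j) eᵢ)`. [folklore] -/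
theorem shearMap_amp_neg_proj (i j : d) (P : ShearProfile) (c : ℝ) (y : EuclideanSpace ℝ d) :
    shearMap i j (amp P (-c)) (proj y) = proj (y + (c * P (y j)) • EuclideanSpace.single i (1 : ℝ)) := by
  rw [shearMap_proj, shearMapLift, amp_apply]
  congr 1
  rw [sub_eq_add_neg, ← neg_smul, neg_mul, neg_neg]

/-! ## The pull-back `G(t) = θ(t) ∘ Φ_t` on a shear slot: smoothness and time derivative -/

section Moved

variable {F : Type*} [NormedAddCommGroup F] [NormedSpace ℝ F]
variable {i j : Fin 2}

/-- **The pull-back is jointly smooth on a time set** `S` when `θ` is and the accumulated shear `Γ` is smooth on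
`S` (the tree's `ShearStage.isSmoothSpaceTimeOn_moved` is the case `S = univ`). [folklore] -/
theorem isSmoothSpaceTimeOn_moved_of_contDiffOn {S : Set ℝ} (i j : Fin 2) (P : ShearProfile) {Γ : ℝ → ℝ}
    (hΓ : ContDiffOn ℝ ∞ Γ S) {θ : ℝ → UnitAddTorus (Fin 2) → F} (hθ : IsSmoothSpaceTimeOn S θ) :
    IsSmoothSpaceTimeOn S (moved θ i j P (-Γ)) := by
  -- `stLift (moved θ) = stLift θ ∘ Ψ`, `Ψ (t, y) = (t, y + Γ t φ(y_j) eᵢ)`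
  have hlift : stLift (moved θ i j P (-Γ)) = stLift θ ∘ fun p : ℝ × EuclideanSpace ℝ (Fin 2) =>
      (p.1, p.2 + (Γ p.1 * P (p.2 j)) • EuclideanSpace.single i (1 : ℝ)) := by
    funext p
    change θ p.1 (shearMap i j (amp P ((-Γ) p.1)) (proj p.2)) = θ p.1 (proj _)
    rw [Pi.neg_apply, shearMap_amp_neg_proj]
  have hcoef : ContDiffOn ℝ ∞ (fun p : ℝ × EuclideanSpace ℝ (Fin 2) => Γ p.1 * P (p.2 j))
      (S ×ˢ (univ : Set (EuclideanSpace ℝ (Fin 2)))) := by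
    refine ContDiffOn.mul (hΓ.comp contDiffOn_fst fun p hp => (mem_prod.1 hp).1) ?_
    exact (P.contDiff.comp ((EuclideanSpace.proj j : EuclideanSpace ℝ (Fin 2) →L[ℝ] ℝ).contDiff.comp
      contDiff_snd)).contDiffOn
  have hΨs : ContDiffOn ℝ ∞ (fun p : ℝ × EuclideanSpace ℝ (Fin 2) =>
      (p.1, p.2 + (Γ p.1 * P (p.2 j)) • EuclideanSpace.single i (1 : ℝ)))
      (S ×ˢ (univ : Set (EuclideanSpace ℝ (Fin 2)))) :=
    contDiffOn_fst.prodMk (contDiffOn_snd.add (hcoef.smul contDiffOn_const))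
  unfold IsSmoothSpaceTimeOn
  rw [hlift]
  exact hθ.comp hΨs fun p hp => mk_mem_prod (mem_prod.1 hp).1 (mem_univ _)

/-- **Time derivative of the pull-back along a time line** (chain rule): if `Γ' = ρ` within `S` at `t ∈ S`, then
`τ ↦ θ(τ, Φ_τ x)` has one-sided derivative `∂ₜθ(t, Φ_t x) + ρ(t) φ(x_j) (∂ᵢθ)(t, Φ_t x)` within `S` at `t`.
[cite: BedrossianCotiZelati2017, §2 (shear coordinates)] -/
theorem hasDerivWithinAt_moved {S : Set ℝ} (hS : UniqueDiffOn ℝ S) (i j : Fin 2) (P : ShearProfile)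
    {Γ ρ : ℝ → ℝ} {t : ℝ} (ht : t ∈ S) (hΓ : HasDerivWithinAt Γ (ρ t) S t)
    {θ : ℝ → UnitAddTorus (Fin 2) → F} (hθ : IsSmoothSpaceTimeOn S θ) (x : UnitAddTorus (Fin 2)) :
    HasDerivWithinAt (fun τ => moved θ i j P (-Γ) τ x)
      (timeDerivWithin S θ t (moved (fun _ y => y) i j P (-Γ) t x) +
        (ρ t * P.onCircle (x j)) • partialDeriv i (θ t) (moved (fun _ y => y) i j P (-Γ) t x)) S t := by
  obtain ⟨y, rfl⟩ := proj_surjective x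
  -- the moving base point
  set c : ℝ → EuclideanSpace ℝ (Fin 2) :=
    fun τ => y + (Γ τ * P (y j)) • EuclideanSpace.single i (1 : ℝ) with hc
  have hmove : ∀ τ, moved (fun _ y => y) i j P (-Γ) τ (proj y) = proj (c τ) := fun τ => by
    rw [moved_apply, Pi.neg_apply, shearMap_amp_neg_proj]
  have hfun : (fun τ => moved θ i j P (-Γ) τ (proj y)) = fun τ => stLift θ (τ, c τ) := by
    funext τ
    rw [moved_apply, Pi.neg_apply, shearMap_amp_neg_proj, stLift_apply]
  have hcd : HasDerivWithinAt c ((ρ t * P (y j)) • EuclideanSpace.single i (1 : ℝ)) S t :=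
    ((hΓ.mul_const _).smul_const (EuclideanSpace.single i (1 : ℝ))).const_add y
  have hpair : HasDerivWithinAt (fun τ => ((τ, c τ) : ℝ × EuclideanSpace ℝ (Fin 2)))
      ((1 : ℝ), (ρ t * P (y j)) • EuclideanSpace.single i (1 : ℝ)) S t :=
    (hasDerivWithinAt_id t S).prodMk hcd
  have hL : HasFDerivWithinAt (stLift θ) (fderivWithin ℝ (stLift θ) (S ×ˢ univ) (t, c t))
      (S ×ˢ univ) (t, c t) :=
    (hθ.differentiableOn (by simp) (t, c t) (mk_mem_prod ht (mem_univ _))).hasFDerivWithinAt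
  have hcomp := hL.comp_hasDerivWithinAt t hpair fun τ hτ => mk_mem_prod hτ (mem_univ _)
  -- identify the derivative: `L (1, v) = L (1, 0) + L (0, v)`
  have hsplit : ((1 : ℝ), (ρ t * P (y j)) • EuclideanSpace.single i (1 : ℝ)) =
      ((1 : ℝ), (0 : EuclideanSpace ℝ (Fin 2))) +
        ((0 : ℝ), (ρ t * P (y j)) • EuclideanSpace.single i (1 : ℝ)) := by simp
  have h2 : (((0 : ℝ), (ρ t * P (y j)) • EuclideanSpace.single i (1 : ℝ)) : ℝ × EuclideanSpace ℝ (Fin 2)) =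
      (ρ t * P (y j)) • ((0 : ℝ), EuclideanSpace.single i (1 : ℝ)) := by simp
  have key : fderivWithin ℝ (stLift θ) (S ×ˢ univ) (t, c t)
      ((1 : ℝ), (ρ t * P (y j)) • EuclideanSpace.single i (1 : ℝ)) =
      timeDerivWithin S θ t (moved (fun _ y => y) i j P (-Γ) t (proj y)) +
        (ρ t * P.onCircle ((proj y) j)) • partialDeriv i (θ t) (moved (fun _ y => y) i j P (-Γ) t (proj y)) := by
    rw [hsplit, map_add, h2, map_smul, hmove, hθ.timeDerivWithin_apply_proj hS ht,
      partialDeriv_eq_fderiv_apply ((hθ.isSmooth_slice ht).isContDiff (by simp)),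
      hθ.fderiv_slice_apply ht]
    simp [hc]
  rw [hfun]
  exact hcomp.congr_deriv key

/-- The one-sided time derivative of the pull-back on a time set of unique differentiability.
[cite: BedrossianCotiZelati2017, §2 (shear coordinates)] -/
theorem timeDerivWithin_moved {S : Set ℝ} (hS : UniqueDiffOn ℝ S) (i j : Fin 2) (P : ShearProfile)
    {Γ ρ : ℝ → ℝ} {t : ℝ} (ht : t ∈ S) (hΓ : HasDerivWithinAt Γ (ρ t) S t)
    {θ : ℝ → UnitAddTorus (Fin 2) → F} (hθ : IsSmoothSpaceTimeOn S θ) (x : UnitAddTorus (Fin 2)) :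
    timeDerivWithin S (moved θ i j P (-Γ)) t x =
      timeDerivWithin S θ t (moved (fun _ y => y) i j P (-Γ) t x) +
        (ρ t * P.onCircle (x j)) • partialDeriv i (θ t) (moved (fun _ y => y) i j P (-Γ) t x) :=
  (hasDerivWithinAt_moved hS i j P ht hΓ hθ x).derivWithin (hS t ht)

/-- **Lagrangian form of the advection–diffusion equation on a shear slot.** If `θ` is a classical solution
of `∂ₜθ + u·∇θ = κΔθ` on `S × 𝕋²` with the shear velocity `u(t) = ShearStage.drift i j φ (ρ t)`
(`= ρ(t) φ(x_j) eᵢ`, `i ≠ j`) and `Γ' = ρ` within `S` at `t`, then the pull-back `G = ShearStage.moved θ i j φ (−Γ)`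
satisfies `∂ₜG(t, x) = κ (Δθ(t))(Φ_t x)`: the transport term is absorbed.
[cite: BedrossianCotiZelati2017, §2 (in shear coordinates the equation is a drift-free heat equation)] -/
theorem timeDerivWithin_moved_eq_laplacian {S : Set ℝ} (hS : UniqueDiffOn ℝ S) (hij : i ≠ j)
    (P : ShearProfile) {Γ ρ : ℝ → ℝ} {κ : ℝ}
    {u : ℝ → UnitAddTorus (Fin 2) → EuclideanSpace ℝ (Fin 2)} {θ : ℝ → UnitAddTorus (Fin 2) → ℝ}
    (hθ : FluidPDE.Torus.IsClassicalScalarTransportOn S κ u θ) (hu : ∀ t ∈ S, u t = drift i j P (ρ t))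
    {t : ℝ} (ht : t ∈ S) (hΓ : HasDerivWithinAt Γ (ρ t) S t) (x : UnitAddTorus (Fin 2)) :
    timeDerivWithin S (moved θ i j P (-Γ)) t x =
      κ * laplacian (θ t) (moved (fun _ y => y) i j P (-Γ) t x) := by
  rw [timeDerivWithin_moved hS i j P ht hΓ hθ.smooth_scalar x]
  have htr := hθ.transport t ht (moved (fun _ y => y) i j P (-Γ) t x)
  have hzj : moved (fun _ y => y) i j P (-Γ) t x j = x j := shearMap_apply_of_ne _ x hij.symm
  have hin : ⟪u t (moved (fun _ y => y) i j P (-Γ) t x),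
      Torus.gradient (θ t) (moved (fun _ y => y) i j P (-Γ) t x)⟫_ℝ =
      (ρ t * P.onCircle (x j)) * partialDeriv i (θ t) (moved (fun _ y => y) i j P (-Γ) t x) := by
    rw [hu t ht, drift_apply, hzj, real_inner_smul_left, real_inner_comm, Torus.inner_gradient_left,
      ← partialDeriv_eq_fderiv_apply ((hθ.smooth_scalar.isSmooth_slice ht).isContDiff (by simp))]
  rw [smul_eq_mul, ← hin]
  linarith [htr]

end Moved

/-! ## The pulled-back Green identity on `𝕋²` -/

section Green

variable {i j : Fin 2}

/-- On `Fin 2`, a sum over both indices is the sum over `i` and `j ≠ i`. [folklore] -/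
theorem sum_univ_eq_add {M : Type*} [AddCommMonoid M] (hij : i ≠ j) (f : Fin 2 → M) :
    ∑ l, f l = f i + f j := by
  have huniv : (Finset.univ : Finset (Fin 2)) = {i, j} := by
    ext l
    simp only [Finset.mem_univ, Finset.mem_insert, Finset.mem_singleton, true_iff]
    fin_cases i <;> fin_cases j <;> fin_cases l <;> simp_all
  rw [huniv, Finset.sum_pair hij]

/-- `∂ᵢ (a ∘ Φ) = (∂ᵢ a) ∘ Φ` for `Φ = shearMap i j (c•φ)`, `i ≠ j` (the sheared direction). [folklore] -/
theorem partialDeriv_i_comp_shear (hij : i ≠ j) {F : Type*} [NormedAddCommGroup F] [NormedSpace ℝ F]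
    {a : UnitAddTorus (Fin 2) → F} (ha : IsSmooth a) (P : ShearProfile) (c : ℝ) (x : UnitAddTorus (Fin 2)) :
    partialDeriv i (a ∘ shearMap i j (amp P c)) x = partialDeriv i a (shearMap i j (amp P c) x) := by
  rw [partialDeriv_comp_shearMap ha, if_neg hij, sub_zero]

/-- `∂ⱼ (a ∘ Φ)(x) = (∂ⱼ a)(Φ x) − c φ'(x_j) (∂ᵢ a)(Φ x)` for `Φ = shearMap i j (c•φ)`. [folklore] -/
theorem partialDeriv_j_comp_shear {a : UnitAddTorus (Fin 2) → ℝ} (ha : IsSmooth a)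
    (P : ShearProfile) (c : ℝ) (x : UnitAddTorus (Fin 2)) :
    partialDeriv j (a ∘ shearMap i j (amp P c)) x =
      partialDeriv j a (shearMap i j (amp P c) x) -
        c * partialDeriv j (fun x : UnitAddTorus (Fin 2) => P.onCircle (x j)) x *
          partialDeriv i a (shearMap i j (amp P c) x) := by
  rw [partialDeriv_comp_shearMap ha, if_pos rfl, partialDeriv_onCircle_comp_amp, smul_eq_mul]

/-- **Change of variables for the slot shear**: `∫ a · (g ∘ Φ) = ∫ (a ∘ Φ⁻¹) · g` with
`Φ = shearMap i j ((-c)•φ)`, `Φ⁻¹ = shearMap i j (c•φ)` (`Torus.integral_comp_shearMap`). [folklore] -/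
theorem integral_mul_comp_shear (hij : i ≠ j) (P : ShearProfile) (c : ℝ)
    (a g : UnitAddTorus (Fin 2) → ℝ) :
    ∫ x, a x * g (shearMap i j (amp P (-c)) x) = ∫ y, a (shearMap i j (amp P c) y) * g y := by
  rw [← integral_comp_shearMap hij (amp P (-c)) (fun y => a (shearMap i j (amp P c) y) * g y)]
  refine integral_congr_ae (Filter.Eventually.of_forall fun x => ?_)
  simp only [shearMap_amp_neg_apply hij c P x]

/-- **Pulled-back Green identity.** For smooth real `a`, `θ` on `𝕋²`, `Φ = x ↦ x + c φ(x_j) eᵢ`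
(`= shearMap i j ((-c)•φ)`, `i ≠ j`) and `G = θ ∘ Φ`:
`∫ a(x) (Δθ)(Φ x) dx = −∫ (∂ᵢa ∂ᵢG + D̄a D̄G)` with the transversal slot derivative
`D̄ = ∂ⱼ − c φ'(x_j) ∂ᵢ` (slope written as `∂ⱼ(x ↦ φ(x_j))`).
[cite: BedrossianCotiZelati2017, §2 (energy identities in shear coordinates)] -/
theorem integral_mul_laplacian_comp_shear (hij : i ≠ j) (P : ShearProfile) (c : ℝ)
    {a θ : UnitAddTorus (Fin 2) → ℝ} (ha : IsSmooth a) (hθ : IsSmooth θ) :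
    ∫ x, a x * laplacian θ (shearMap i j (amp P (-c)) x) =
      -∫ x, (partialDeriv i a x * partialDeriv i (θ ∘ shearMap i j (amp P (-c))) x +
        (partialDeriv j a x -
            c * partialDeriv j (fun x : UnitAddTorus (Fin 2) => P.onCircle (x j)) x * partialDeriv i a x) *
          (partialDeriv j (θ ∘ shearMap i j (amp P (-c))) x -
            c * partialDeriv j (fun x : UnitAddTorus (Fin 2) => P.onCircle (x j)) x *
              partialDeriv i (θ ∘ shearMap i j (amp P (-c))) x)) := by
  have hΦΨ : ∀ y, shearMap i j (amp P (-c)) (shearMap i j (amp P c) y) = y := fun y => by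
    simpa only [neg_neg] using shearMap_amp_neg_apply hij (-c) P y
  have haΨ : IsSmooth (a ∘ shearMap i j (amp P c)) := ha.comp_shearMap i j _
  have hsl : IsSmooth (fun x : UnitAddTorus (Fin 2) => P.onCircle (x j)) := isSmooth_onCircle_comp' P j
  -- change variables, integrate by parts
  rw [integral_mul_comp_shear hij P c a (laplacian θ)]
  change ∫ y, (a ∘ shearMap i j (amp P c)) y * laplacian θ y = _
  rw [integral_mul_laplacian_eq_neg_sum haΨ hθ, sum_univ_eq_add hij]
  -- the two chain rules, written at `y = Φ x`
  have hi : ∀ y, partialDeriv i (a ∘ shearMap i j (amp P c)) y * partialDeriv i θ y =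
      (fun x => partialDeriv i a x * partialDeriv i (θ ∘ shearMap i j (amp P (-c))) x)
        (shearMap i j (amp P c) y) := fun y => by
    simp only
    rw [partialDeriv_i_comp_shear hij ha, partialDeriv_i_comp_shear hij hθ, hΦΨ]
  have hj : ∀ y, partialDeriv j (a ∘ shearMap i j (amp P c)) y * partialDeriv j θ y =
      (fun x => (partialDeriv j a x -
            c * partialDeriv j (fun x : UnitAddTorus (Fin 2) => P.onCircle (x j)) x * partialDeriv i a x) *
          (partialDeriv j (θ ∘ shearMap i j (amp P (-c))) x -
            c * partialDeriv j (fun x : UnitAddTorus (Fin 2) => P.onCircle (x j)) x *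
              partialDeriv i (θ ∘ shearMap i j (amp P (-c))) x))
        (shearMap i j (amp P c) y) := fun y => by
    have hslope : partialDeriv j (fun x : UnitAddTorus (Fin 2) => P.onCircle (x j)) (shearMap i j (amp P c) y) =
        partialDeriv j (fun x : UnitAddTorus (Fin 2) => P.onCircle (x j)) y := by
      obtain ⟨z, rfl⟩ := proj_surjective y
      rw [shearMap_proj, partialDeriv_onCircle_comp, partialDeriv_onCircle_comp, if_pos rfl, if_pos rfl]
      simp [shearMapLift, hij.symm]
    simp only
    rw [partialDeriv_j_comp_shear ha, partialDeriv_j_comp_shear hθ, partialDeriv_i_comp_shear hij hθ,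
      hΦΨ, hslope]
    ring
  simp_rw [hi, hj]
  rw [integral_comp_shearMap hij (amp P c)
      (fun x => partialDeriv i a x * partialDeriv i (θ ∘ shearMap i j (amp P (-c))) x),
    integral_comp_shearMap hij (amp P c)
      (fun x => (partialDeriv j a x -
            c * partialDeriv j (fun x : UnitAddTorus (Fin 2) => P.onCircle (x j)) x * partialDeriv i a x) *
          (partialDeriv j (θ ∘ shearMap i j (amp P (-c))) x -
            c * partialDeriv j (fun x : UnitAddTorus (Fin 2) => P.onCircle (x j)) x *
              partialDeriv i (θ ∘ shearMap i j (amp P (-c))) x)),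
    ← integral_add]
  · have h1 : IsSmooth (fun x => partialDeriv i a x * partialDeriv i (θ ∘ shearMap i j (amp P (-c))) x) :=
      (ha.partialDeriv i).mul ((hθ.comp_shearMap i j _).partialDeriv i)
    exact h1.integrable
  · have hG : IsSmooth (θ ∘ shearMap i j (amp P (-c))) := hθ.comp_shearMap i j _
    have hDa : IsSmooth (fun x => partialDeriv j a x -
        c * partialDeriv j (fun x : UnitAddTorus (Fin 2) => P.onCircle (x j)) x * partialDeriv i a x) := by
      have h' : IsSmooth (fun x => c * partialDeriv j (fun x : UnitAddTorus (Fin 2) => P.onCircle (x j)) x *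
          partialDeriv i a x) :=
        ((isSmooth_const (d := Fin 2) c).mul (hsl.partialDeriv j)).mul (ha.partialDeriv i)
      exact (ha.partialDeriv j).sub h'
    have hDG : IsSmooth (fun x => partialDeriv j (θ ∘ shearMap i j (amp P (-c))) x -
        c * partialDeriv j (fun x : UnitAddTorus (Fin 2) => P.onCircle (x j)) x *
          partialDeriv i (θ ∘ shearMap i j (amp P (-c))) x) := by
      have h' : IsSmooth (fun x => c * partialDeriv j (fun x : UnitAddTorus (Fin 2) => P.onCircle (x j)) x *
          partialDeriv i (θ ∘ shearMap i j (amp P (-c))) x) :=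
        ((isSmooth_const (d := Fin 2) c).mul (hsl.partialDeriv j)).mul (hG.partialDeriv i)
      exact (hG.partialDeriv j).sub h'
    have h2 : IsSmooth (fun x => (partialDeriv j a x -
            c * partialDeriv j (fun x : UnitAddTorus (Fin 2) => P.onCircle (x j)) x * partialDeriv i a x) *
          (partialDeriv j (θ ∘ shearMap i j (amp P (-c))) x -
            c * partialDeriv j (fun x : UnitAddTorus (Fin 2) => P.onCircle (x j)) x *
              partialDeriv i (θ ∘ shearMap i j (amp P (-c))) x)) := hDa.mul hDG
    exact h2.integrable

end Green

end Summit.AnomalousDissipation.AnomalousDissipation.Theorems.SawtoothPulseCascade.K1Slot
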